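import Mathlib
import Literature.Geometry.Riemannian.MeanConvexLevelSetFlow
import Literature.Geometry.Manifold.EmbeddingRangeDiffeomorph
import Literature.Topology.FourManifolds.ImmersionCriterion
import Literature.Topology.FourManifolds.KnotFraming
import HarnessLib

/-!
# A cross-section of `S⁴ × ℝ` whose time-`0` level set flow is an embedded `S⁴` is a standard sphere

Line `proxy-models-below-bubble-sheet` of crux `CylinderEntropy.CylinderRungTwo` (stmt-SmoothPoincare4-7631),
stub `stub_tameSurgeryStructure` (`TameSurgeryStructure`, statement 5: structure of tame thin flows). This file
is the `T₀ = 0` case of that statement — its `sphere` leaf at time zero — written WITHOUT the line's local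
vocabulary (no `IsCylinderPresentation`, `flowTrack`, `IsProxyResolvable`), so that it only speaks about tree
objects: Mathlib's `C^∞` embeddings `Manifold.IsSmoothEmbedding`, the tree's pseudo-Riemannian metrics
`Literature.Geometry.Lorentzian.PseudoRiemannianMetric` and White's biggest flow
`Literature.Geometry.Riemannian.levelSetFlow` (`MeanConvexLevelSetFlow.lean`).

## What

Let `(Ncar, gN, emb)` present the round cylinder: `Ncar` an abstract `C^∞` 5-manifold, `gN` a metric with its
Levi-Civita connection, `emb : Ncar → ℝ⁶` a smooth embedding with image `N = {z | ∑_{i<5} zᵢ² = 1}` (the metric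
identity `gN(v,v) = ‖d emb v‖²` of a presentation is not needed here). Let `P` be a closed smooth 4-manifold,
`κ : P → ℝ⁶` a smooth embedding with image in `N`, and suppose the time-`0` level set flow in `(Ncar, gN)` of the
cross-section `K₀ = emb ⁻¹' (κ P)` is the image of a smooth embedding `φ : S⁴ → Ncar`. Then `P ≅ S⁴`
(`nonempty_diffeomorph_sphere_of_range_eq_levelSetFlow_zero`).

## Proof (fact-free)

`κ P` is compact, hence closed, so `K₀` is closed and the tree's `levelSetFlow_zero` (the instantly vanishing weak
set flow) gives `F₀(K₀) = K₀`; thus `range φ = emb ⁻¹' (κ P)` and, as `κ P ⊆ N = range emb`,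
`range (emb ∘ φ) = κ P`. The composite `emb ∘ φ : S⁴ → ℝ⁶` is a smooth embedding
(`isSmoothEmbedding_comp`: compact source, injective, and injective differential by the chain rule and the
tree's `Manifold.IsImmersionAt.mfderiv_injective`, fed to the tree's
`Literature.Topology.FourManifolds.isSmoothEmbedding_of_injective_of_injective_mfderiv` — Mathlib has
`Manifold.IsSmoothEmbedding.comp` only as a `proof_wanted`). Two smooth embeddings with the same image have
diffeomorphic sources (tree `Literature.Geometry.Manifold.nonempty_diffeomorph_of_range_eq`, Lee Thm. 5.31).

## References

* [LeeSmoothManifolds2013] J. M. Lee, *Introduction to Smooth Manifolds*, 2nd ed., GTM 218, Springer 2013,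
  Thm. 5.31 (uniqueness of the smooth structure on an embedded submanifold).
* [HirschDT1976] M. W. Hirsch, *Differential Topology*, GTM 33, Springer 1976, Ch. 1 §3 Thm. 3.1 (an injective
  immersion of a compact manifold is an embedding).
* [HershkovitsWhite2019] O. Hershkovits, B. White, *Nonfattening of mean curvature flow at singularities of
  mean convex type*, CPAM 73 (2020), §1 p. 3 (`F_0(X) = X`).
-/

-- the prescribed namespace `Summit.SmoothPoincare4.SmoothPoincare4.…` repeats `SmoothPoincare4`
set_option linter.dupNamespace false

open scoped Manifold ContDiff Topology BigOperators
open Set Function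
open Literature.Geometry.Riemannian (levelSetFlow levelSetFlow_zero)
open Literature.Geometry.Lorentzian (PseudoRiemannianMetric)

noncomputable section

namespace Summit.SmoothPoincare4.SmoothPoincare4.Theorems.CylinderRungTwo.ProxyModels.TimeZero

/-! ### Composition of smooth embeddings (compact source) -/

section Comp

variable {E₁ E₂ E₃ : Type*} [NormedAddCommGroup E₁] [NormedSpace ℝ E₁]
  [NormedAddCommGroup E₂] [NormedSpace ℝ E₂] [NormedAddCommGroup E₃] [NormedSpace ℝ E₃]
  {H₁ H₂ H₃ : Type*} [TopologicalSpace H₁] [TopologicalSpace H₂] [TopologicalSpace H₃]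
  {I : ModelWithCorners ℝ E₁ H₁} {J : ModelWithCorners ℝ E₂ H₂} {K : ModelWithCorners ℝ E₃ H₃}
  {M : Type*} [TopologicalSpace M] [ChartedSpace H₁ M] [IsManifold I ∞ M]
  {N : Type*} [TopologicalSpace N] [ChartedSpace H₂ N] [IsManifold J ∞ N]
  {N' : Type*} [TopologicalSpace N'] [ChartedSpace H₃ N'] [IsManifold K ∞ N']

/-- **The differential of a composite of two `C^∞` immersions is injective** (chain rule
`d(g ∘ f)_x = dg_{f x} ∘ df_x`, Mathlib `mfderiv_comp`, and injectivity of the differential of an immersion,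
tree `Manifold.IsImmersionAt.mfderiv_injective`). [folklore] -/
theorem injective_mfderiv_comp_of_isImmersion {f : M → N} {g : N → N'}
    (hg : Manifold.IsImmersion J K ∞ g) (hf : Manifold.IsImmersion I J ∞ f) (x : M) :
    Injective (mfderiv I K (g ∘ f) x) := by
  have hfd : MDifferentiableAt I J f x := (hf.contMDiff x).mdifferentiableAt (by simp)
  have hgd : MDifferentiableAt J K g (f x) := (hg.contMDiff (f x)).mdifferentiableAt (by simp)
  have hgx : Manifold.IsImmersionAt J K ∞ g (f x) := hg.isImmersionAt (f x)
  have hfx : Manifold.IsImmersionAt I J ∞ f x := hf.isImmersionAt x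
  rw [mfderiv_comp x hgd hfd]
  exact (Literature.Topology.FourManifolds.Manifold.IsImmersionAt.mfderiv_injective hgx (by simp)).comp
    (Literature.Topology.FourManifolds.Manifold.IsImmersionAt.mfderiv_injective hfx (by simp))

/-- **A composite of `C^∞` embeddings out of a compact manifold is a `C^∞` embedding** (in Mathlib's chart
sense `Manifold.IsSmoothEmbedding`; Mathlib records the general statement only as the `proof_wanted`
`Manifold.IsSmoothEmbedding.comp`). For a compact boundaryless source and a Hausdorff boundaryless target, both on
finite-dimensional real models: `g ∘ f` is `C^∞`, injective, with everywhere injective differential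
(`injective_mfderiv_comp_of_isImmersion`), hence an embedding by the tree's
`Literature.Topology.FourManifolds.isSmoothEmbedding_of_injective_of_injective_mfderiv` (Hirsch, Ch. 1 §3
Thm. 3.1). [cite: HirschDT1976, Ch. 1 §3 Thm. 3.1] -/
theorem isSmoothEmbedding_comp [FiniteDimensional ℝ E₁] [FiniteDimensional ℝ E₃] [I.Boundaryless]
    [K.Boundaryless] [CompactSpace M] [T2Space N'] {f : M → N} {g : N → N'}
    (hg : Manifold.IsSmoothEmbedding J K ∞ g) (hf : Manifold.IsSmoothEmbedding I J ∞ f) :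
    Manifold.IsSmoothEmbedding I K ∞ (g ∘ f) :=
  Literature.Topology.FourManifolds.isSmoothEmbedding_of_injective_of_injective_mfderiv
    (hg.contMDiff.comp hf.contMDiff) (by simp)
    (hg.isEmbedding.injective.comp hf.isEmbedding.injective)
    (injective_mfderiv_comp_of_isImmersion hg.isImmersion hf.isImmersion)

end Comp

/-! ### The time-zero sphere -/

section TimeZero

/-- **Range of a lift through a map onto the cylinder.** If `emb : Ncar → ℝ⁶` has range
`N = {∑_{i<5} zᵢ² = 1}`, `κ : P → ℝ⁶` takes values in `N`, and `φ : Q → Ncar` has range `emb ⁻¹' (range κ)`, then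
`range (emb ∘ φ) = range κ`. [folklore] -/
theorem range_comp_eq_of_range_eq_preimage {Ncar P Q : Type*} {emb : Ncar → EuclideanSpace ℝ (Fin 6)}
    (hrange : Set.range emb = {z : EuclideanSpace ℝ (Fin 6) | ∑ i : Fin 5, z (Fin.castSucc i) ^ 2 = 1})
    {κ : P → EuclideanSpace ℝ (Fin 6)} (hκN : ∀ x, ∑ i : Fin 5, κ x (Fin.castSucc i) ^ 2 = 1)
    {φ : Q → Ncar} (hφr : Set.range φ = emb ⁻¹' Set.range κ) :
    Set.range (emb ∘ φ) = Set.range κ := by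
  rw [Set.range_comp, hφr, Set.image_preimage_eq_inter_range, Set.inter_eq_left, hrange]
  rintro _ ⟨x, rfl⟩
  exact hκN x

variable {Ncar : Type} [TopologicalSpace Ncar] [ChartedSpace (EuclideanSpace ℝ (Fin 5)) Ncar]
  [IsManifold (𝓡 5) ∞ Ncar]

/-- **The `T₀ = 0` case of statement 5 (`TameSurgeryStructure`) of line `proxy-models-below-bubble-sheet`: a
cross-section whose time-`0` level set flow is an embedded `S⁴` is a standard sphere.** Let `emb : Ncar → ℝ⁶`
be a smooth embedding of an abstract `5`-manifold onto `N = {∑_{i<5} zᵢ² = 1} = S⁴ × ℝ`, `gN` a metric on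
`Ncar` with its Levi-Civita connection, `P` a closed smooth `4`-manifold, `κ : P → ℝ⁶` a smooth embedding with
image in `N`, and `φ : S⁴ → Ncar` a smooth embedding whose image is the time-`0` level set flow
(`Literature.Geometry.Riemannian.levelSetFlow`, White's biggest flow) of `K₀ = emb ⁻¹' (κ P)` in `(Ncar, gN)`.
Then `P` is diffeomorphic to `S⁴` (only compactness of `P` is used: the Hausdorff, second-countability and
`IsManifold` instances of the stub's quantifier block are not needed and are inferred at the call site). Proof: `K₀` is closed (`κ P` compact), so `F₀(K₀) = K₀` (tree
`levelSetFlow_zero`), whence `range (emb ∘ φ) = κ P`; `emb ∘ φ` is a smooth embedding (`isSmoothEmbedding_comp`),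
and two smooth embeddings with the same image have diffeomorphic sources (tree
`Literature.Geometry.Manifold.nonempty_diffeomorph_of_range_eq`). [cite: LeeSmoothManifolds2013, Thm. 5.31] -/
theorem nonempty_diffeomorph_sphere_of_range_eq_levelSetFlow_zero
    (gN : PseudoRiemannianMetric (𝓡 5) ∞ (EuclideanSpace ℝ (Fin 5)) (TangentSpace (𝓡 5) : Ncar → Type _))
    [gN.HasLeviCivita] {emb : Ncar → EuclideanSpace ℝ (Fin 6)}
    (hemb : Manifold.IsSmoothEmbedding (𝓡 5) (𝓡 6) ∞ emb)
    (hrange : Set.range emb = {z : EuclideanSpace ℝ (Fin 6) | ∑ i : Fin 5, z (Fin.castSucc i) ^ 2 = 1})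
    {P : Type} [TopologicalSpace P] [CompactSpace P] [ChartedSpace (EuclideanSpace ℝ (Fin 4)) P]
    {κ : P → EuclideanSpace ℝ (Fin 6)} (hκ : Manifold.IsSmoothEmbedding (𝓡 4) (𝓡 6) ∞ κ)
    (hκN : ∀ x, ∑ i : Fin 5, κ x (Fin.castSucc i) ^ 2 = 1)
    {φ : Metric.sphere (0 : EuclideanSpace ℝ (Fin 5)) 1 → Ncar}
    (hφ : Manifold.IsSmoothEmbedding (𝓡 4) (𝓡 5) ∞ φ)
    (hφr : Set.range φ = levelSetFlow gN (emb ⁻¹' Set.range κ) 0) :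
    Nonempty (P ≃ₘ⟮𝓡 4, 𝓡 4⟯ Metric.sphere (0 : EuclideanSpace ℝ (Fin 5)) 1) := by
  -- `K₀ = emb ⁻¹' (κ P)` is closed (`κ P` is compact in the Hausdorff `ℝ⁶`), so the time-`0` flow is `K₀`
  have hK₀ : IsClosed (emb ⁻¹' Set.range κ) :=
    (isCompact_range hκ.contMDiff.continuous).isClosed.preimage hemb.contMDiff.continuous
  rw [levelSetFlow_zero hK₀] at hφr
  -- hence `emb ∘ φ` and `κ` are smooth embeddings with the same image
  have hr : Set.range κ = Set.range (emb ∘ φ) :=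
    (range_comp_eq_of_range_eq_preimage hrange hκN hφr).symm
  have hembφ : Manifold.IsSmoothEmbedding (𝓡 4) (𝓡 6) ∞ (emb ∘ φ) := isSmoothEmbedding_comp hemb hφ
  exact Literature.Geometry.Manifold.nonempty_diffeomorph_of_range_eq hκ hembφ hr

/-- **Registered sub-goal `stub_tameSurgeryStructure_timeZero` of crux item stmt-SmoothPoincare4-7631** (the
`T₀ = 0` slice of the registered stub `stub_tameSurgeryStructure : TameSurgeryStructure` of line
`proxy-models-below-bubble-sheet`, in the stub's own quantifier shape and in tree vocabulary only, with the
conclusion `IsProxyResolvable … P` replaced by what its `sphere` leaf consumes, `Nonempty (P ≃ₘ S⁴)`): for every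
presentation `(Ncar, gN, emb)` of `N = S⁴ × ℝ` (smooth embedding `emb` onto `{∑_{i<5} zᵢ² = 1}`; the metric identity of
a presentation is not needed), every closed smooth `4`-manifold `P`, every smooth embedding `κ : P → ℝ⁶` into `N` and every
smooth embedding `φ : S⁴ → Ncar` onto the time-`0` level set flow of `emb ⁻¹' (κ P)`, `P ≅ S⁴`. Immediate from
`nonempty_diffeomorph_sphere_of_range_eq_levelSetFlow_zero`. [cite: LeeSmoothManifolds2013, Thm. 5.31] -/
theorem stub_tameSurgeryStructure_timeZero :
    ∀ (Ncar : Type) [TopologicalSpace Ncar] [ChartedSpace (EuclideanSpace ℝ (Fin 5)) Ncar]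
      [IsManifold (𝓡 5) ∞ Ncar]
      (gN : Literature.Geometry.Lorentzian.PseudoRiemannianMetric (𝓡 5) ∞ (EuclideanSpace ℝ (Fin 5))
        (TangentSpace (𝓡 5) : Ncar → Type _))
      [gN.HasLeviCivita] (emb : Ncar → EuclideanSpace ℝ (Fin 6)),
      Manifold.IsSmoothEmbedding (𝓡 5) (𝓡 6) ∞ emb →
      Set.range emb = {z : EuclideanSpace ℝ (Fin 6) | ∑ i : Fin 5, z (Fin.castSucc i) ^ 2 = 1} →
    ∀ (P : Type) [TopologicalSpace P] [T2Space P] [SecondCountableTopology P] [CompactSpace P]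
      [ChartedSpace (EuclideanSpace ℝ (Fin 4)) P] [IsManifold (𝓡 4) ∞ P] (κ : P → EuclideanSpace ℝ (Fin 6)),
      Manifold.IsSmoothEmbedding (𝓡 4) (𝓡 6) ∞ κ → (∀ x, ∑ i : Fin 5, κ x (Fin.castSucc i) ^ 2 = 1) →
    ∀ φ : Metric.sphere (0 : EuclideanSpace ℝ (Fin 5)) 1 → Ncar,
      Manifold.IsSmoothEmbedding (𝓡 4) (𝓡 5) ∞ φ →
      Set.range φ = Literature.Geometry.Riemannian.levelSetFlow gN (emb ⁻¹' Set.range κ) 0 →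
      Nonempty (P ≃ₘ⟮𝓡 4, 𝓡 4⟯ Metric.sphere (0 : EuclideanSpace ℝ (Fin 5)) 1) := by
  intro Ncar _ _ _ gN _ emb hemb hrange P _ _ _ _ _ _ κ hκ hκN φ hφ hφr
  exact nonempty_diffeomorph_sphere_of_range_eq_levelSetFlow_zero gN hemb hrange hκ hκN hφ hφr

end TimeZero

end Summit.SmoothPoincare4.SmoothPoincare4.Theorems.CylinderRungTwo.ProxyModels.TimeZero

end
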